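import Literature.Topology.FourManifolds.IntersectionFormTopologyProofs
import Literature.AlgebraicTopology.SingularHomology.FundamentalClassExistence
import Literature.AlgebraicTopology.SingularHomology.CohomologyHomotopyInvariance
import Literature.AlgebraicTopology.SingularHomology.UniversalCoefficientsFree
import Literature.AlgebraicTopology.SingularHomology.ExcisionMayerVietorisProofs
import Literature.AlgebraicTopology.FundamentalGroup.SphereSimplyConnected
import HarnessLib

/-!
# `spc4.S09` (Whitehead–Milnor): the "only if" half proved, and the legacy (mis-elaborated) reading refuted

Companion to `Literature.Topology.FourManifolds.IntersectionFormTopology` (the named fact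
`Literature.Topology.FourManifolds.nonempty_homotopyEquiv_iff_equivalent_intersectionForm`,
**spc4.S09**: two closed simply connected topological 4-manifolds are homotopy equivalent iff
their intersection forms are isomorphic up to sign; Whitehead 1949, Milnor 1958, Milnor–Husemoller
1973 §V.1, Freedman–Quinn 1990 §10.1) and to `IntersectionFormTopologyProofs` (orientability).

## Part 1 — homotopy invariance of the intersection form (the "only if" half), PROVED

Freedman–Quinn 1990, §10.1: "A homotopy equivalence also induces an isometry of the form."

* `hasDegree_one_or_neg_one_of_homotopyEquiv` — a homotopy equivalence `e : X ≃ₕ Y` between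
  closed connected `ℤ`-oriented topological `n`-manifolds has degree `±1`, `e_* [X] = ±[Y]`
  (Hatcher 2002, §2.2 (c),(d), run with Thm. 3.26(a): `Hₙ(X; ℤ) → Hₙ(X | x; ℤ) ≅ ℤ` is an
  isomorphism carrying `[X]` to a generator; `exists_linearMap_eq_smul_fundamentalClass`,
  `exists_mul_eq_one_map_fundamentalClass_eq_smul` hold over any commutative ring `R`);
* `intersectionForm_map_map` — `Q_X (f^* a) (f^* b) = d · Q_Y a b` whenever `f_* [X] = d • [Y]`
  (naturality of `⌣`, `cupProduct_map`, and of the Kronecker pairing, `kroneckerPairing_map`);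
* `equivalent_intersectionForm_or_neg_of_homotopyEquiv` — for closed connected `ℤ`-oriented
  `2k`-manifolds, `X ≃ₕ Y` gives `Q_X ≅ Q_Y` or `Q_X ≅ -Q_Y` (`LinearMap.BilinForm.Equivalent`,
  the isometry being `e^*` on `Hᵏ(-; ℤ)/T`, a linear equivalence by homotopy invariance of
  cohomology, `freeCohomology_map_eq_of_homotopic`);
* `equivalent_intersectionForm_or_neg_of_nonempty_homotopyEquiv` — the case `k = 2`: the `→`
  implication of **spc4.S09** for closed simply connected topological 4-manifolds `M`, `N`.

Inputs, all proved in the tree: the fundamental class and `Hₙ(X) ↪ Hₙ(X | x)`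
(`FundamentalClassExistence.lean`, `FundamentalClassProofs.lean`), homotopy invariance of singular
(co)homology (`SingularChains.lean`, `CohomologyHomotopyInvariance.lean`), `cupProduct_map`,
`kroneckerPairing_map` (`CupProduct.lean`, `CapProduct.lean`).

## Part 2 — the LEGACY reading of the named fact is false (why the D-0014 constant had no `…_holds`)

The D-0014 sorry-sweep (2026-08-13) wrote the fact in `IntersectionFormTopology.lean` under
`variable {M : Type u} [TopologicalSpace M] [T2Space M] [ChartedSpace (𝔼 4) M] [CompactSpace M]`
as `def nonempty_homotopyEquiv_iff_equivalent_intersectionForm : Prop := ∀ [SimplyConnectedSpace M]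
{N …} μ ν, Nonempty (M ≃ₕ N) ↔ …`; but a `def` receives only the section variables its body
uses, and the body uses none of `[T2Space M] [ChartedSpace (𝔼 4) M] [CompactSpace M]`, so that
constant elaborated as `∀ {M : Type u} [TopologicalSpace M], Prop` — `M` ranged over ALL simply
connected spaces with a homological `ℤ`-orientation in dimension `4`, while `N` was a genuine
closed simply connected 4-manifold (the same defect of that file was recorded for
`exists_homologicalOrientation_int_of_simplyConnectedSpace` in `IntersectionFormTopologyProofs.lean`).
The theorem `not_nonempty_homotopyEquiv_iff_equivalent_intersectionForm_euclideanSpace` refutes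
that legacy reading at `M = ℝ⁴`, `N = S⁴`: `H²(ℝ⁴; ℤ)/T = H²(S⁴; ℤ)/T = 0`, so both forms are the
zero form on the zero module and the right-hand side holds, yet `ℝ⁴ ≄ S⁴` (`H₄(ℝ⁴; ℤ) = 0`,
`[S⁴] ≠ 0`). It is stated with the legacy body written out at `M := ℝ⁴` (its leading, inhabited
`[SimplyConnectedSpace ℝ⁴]` binder dropped), so that it does not depend on the statement file's
constant: the 2026-08-15 verdict clean-up of `IntersectionFormTopology.lean` re-states
`nonempty_homotopyEquiv_iff_equivalent_intersectionForm` under the same name with the manifold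
hypotheses on `M` as binders of the statement itself (the INTENDED statement below), and this
file keeps the record of why the legacy reading admitted no discharge.

The INTENDED statement — for closed simply connected topological 4-manifolds `M N : Type u`
(all of `[T2Space] [ChartedSpace (𝔼 4)] [CompactSpace] [SimplyConnectedSpace]` on both, written as
binders of the statement itself) with `ℤ`-orientations `μ`, `ν`:
`Nonempty (M ≃ₕ N) ↔ Q_μ ≅ Q_ν ∨ Q_μ ≅ -Q_ν` — is the Whitehead–Milnor theorem (Kirby 1989,
Ch. II §2, Thm. 2.1) and is true; its `→` half is Part 1. Its `←` half (Milnor 1958: the form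
determines the homotopy type) needs the homotopy classification of the Poincaré complexes
`(⋁ʳ S²) ∪_φ e⁴` through `π₃(⋁ʳ S²) ≅ {symmetric integer r × r matrices}` and the reduction of a
closed simply connected 4-manifold to such a complex (Milnor–Husemoller 1973, §V.1,
pp. 103–105; Kirby 1989, pp. 22–23); none of this is in Mathlib or in the tree, and it is NOT
attempted here.

## References

* J. H. C. Whitehead, *On simply connected, 4-dimensional polyhedra*, Comment. Math. Helv. 22
  (1949), 48–92. [Whitehead1949]
* J. Milnor, D. Husemoller, *Symmetric Bilinear Forms*, Springer 1973, §V.1. [MilnorHusemoller1973]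
* M. H. Freedman, F. Quinn, *Topology of 4-Manifolds*, Princeton Math. Series 39, 1990, §10.1
  (Classification Theorem and the remark following it). [FreedmanQuinn1990]
* R. C. Kirby, *The Topology of 4-Manifolds*, LNM 1374, Springer 1989, Ch. II §2, Thm. 2.1
  (p. 22). [Kirby1989]
* A. Hatcher, *Algebraic Topology*, CUP 2002, §2.2 (degree), Cor. 2.14, §3.1 p. 201 and Thm. 3.2,
  §3.2 Prop. 3.10, §3.3 Thm. 3.26. [HatcherAT2002]
-/

noncomputable section

open ContinuousMap CategoryTheory CategoryTheory.Limits

namespace Literature.Topology.FourManifolds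

open Literature.AlgebraicTopology.SingularHomology

universe u v

variable {R : Type v} [CommRing R]
variable {X Y : Type u} [TopologicalSpace X] [TopologicalSpace Y]

/-! ### Homotopy invariance of cohomology modulo torsion -/

/-- Homotopic maps `f ≃ g : X → Y` induce the same map `f^* = g^*` on cohomology modulo torsion
`Hᵏ(Y; R)/T → Hᵏ(X; R)/T` (Hatcher 2002, §3.1, p. 201, homotopy invariance of cohomology, passed
to the quotient by torsion). [cite: HatcherAT2002, §3.1 p. 201] -/
theorem freeCohomology_map_eq_of_homotopic {f g : C(X, Y)} (hfg : f.Homotopic g) (k : ℕ) :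
    freeCohomology.map (R := R) f k = freeCohomology.map g k := by
  ext x
  induction x using freeCohomology.induction_on with
  | h a =>
    rw [freeCohomology.map_mk, freeCohomology.map_mk,
      singularCohomology.map_eq_of_homotopic' R R hfg k]

/-- For a homotopy equivalence `e : X ≃ₕ Y` with homotopy inverse `e⁻¹`, `e^* ∘ (e⁻¹)^* = 𝟙` on
`Hᵏ(X; R)/T` (Hatcher 2002, §3.1, dual of Cor. 2.11, modulo torsion). [cite: HatcherAT2002, §3.1 p. 201] -/
theorem freeCohomology_map_comp_map_symm (e : X ≃ₕ Y) (k : ℕ) :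
    (freeCohomology.map (R := R) e.toFun k).comp (freeCohomology.map e.invFun k) = LinearMap.id := by
  rw [← freeCohomology.map_comp, freeCohomology_map_eq_of_homotopic e.left_inv, freeCohomology.map_id]

/-- For a homotopy equivalence `e : X ≃ₕ Y` with homotopy inverse `e⁻¹`, `(e⁻¹)^* ∘ e^* = 𝟙` on
`Hᵏ(Y; R)/T` (Hatcher 2002, §3.1, dual of Cor. 2.11, modulo torsion). [cite: HatcherAT2002, §3.1 p. 201] -/
theorem freeCohomology_map_symm_comp_map (e : X ≃ₕ Y) (k : ℕ) :
    (freeCohomology.map (R := R) e.invFun k).comp (freeCohomology.map e.toFun k) = LinearMap.id := by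
  rw [← freeCohomology.map_comp, freeCohomology_map_eq_of_homotopic e.right_inv, freeCohomology.map_id]

/-! ### The degree of a homotopy equivalence -/

variable {n : ℕ}

/-- On a closed connected `R`-oriented topological `n`-manifold every class `c ∈ Hₙ(X; R)` is a
well-defined multiple of the fundamental class: there is an `R`-linear `Φ : Hₙ(X; R) → R` with
`Φ [X] = 1` and `c = Φ c • [X]` for all `c` (Hatcher 2002, §3.3, Thm. 3.26(a): `Hₙ(X; R) → Hₙ(X | x; R) ≅ R`
is an isomorphism taking `[X]` to the generator `μₓ`). Here `Φ` is `Hₙ(X; R) → Hₙ(X | x; R) ≃ R` for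
some point `x`. [cite: HatcherAT2002, Thm. 3.26(a)] -/
theorem exists_linearMap_eq_smul_fundamentalClass [CompactSpace X] [T2Space X]
    [ChartedSpace (EuclideanSpace ℝ (Fin n)) X] [ConnectedSpace X] (μ : HomologicalOrientation R X n) :
    ∃ Φ : singularHomology R R X n →ₗ[R] R,
      Φ μ.fundamentalClass = 1 ∧ ∀ c, c = Φ c • μ.fundamentalClass := by
  obtain ⟨x⟩ := (inferInstance : Nonempty X)
  obtain ⟨e, he⟩ := μ.isGenerator x
  have hfc : singularHomology.toLocal R R x n μ.fundamentalClass = μ.localClass x :=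
    HomologicalOrientation.isFundamentalClass_fundamentalClass_holds (R := R) (X := X) n μ x
  refine ⟨e.toLinearMap.comp (singularHomology.toLocal R R x n).hom, ?_, fun c => ?_⟩
  · change e (singularHomology.toLocal R R x n μ.fundamentalClass) = 1
    rw [hfc, he]
  · apply singularHomology.toLocal_injective_of_connectedSpace_holds R R X n x
    rw [map_smul, hfc]
    apply e.injective
    rw [map_smul, he, smul_eq_mul, mul_one]
    rfl

/-- For a homotopy equivalence `e : X ≃ₕ Y` between closed connected `R`-oriented topological
`n`-manifolds, `e_* [X] = d • [Y]` for a unit `d ∈ R` with inverse the corresponding coefficient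
of `e⁻¹`: `(e⁻¹ ∘ e)_* = 𝟙` forces `d · d' = 1` (Hatcher 2002, §2.2, properties (c), (d) of the
degree, run with Thm. 3.26(a) in place of `Hₙ(Sⁿ) ≅ ℤ`). [cite: HatcherAT2002, §2.2 (c),(d) and Thm. 3.26(a)] -/
theorem exists_mul_eq_one_map_fundamentalClass_eq_smul [CompactSpace X] [T2Space X]
    [ChartedSpace (EuclideanSpace ℝ (Fin n)) X] [ConnectedSpace X] [CompactSpace Y] [T2Space Y]
    [ChartedSpace (EuclideanSpace ℝ (Fin n)) Y] [ConnectedSpace Y]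
    (μ : HomologicalOrientation R X n) (ν : HomologicalOrientation R Y n) (e : X ≃ₕ Y) :
    ∃ d d' : R, d * d' = 1 ∧
      singularHomology.map R R e.toFun n μ.fundamentalClass = d • ν.fundamentalClass := by
  obtain ⟨Φ, hΦ1, hΦ⟩ := exists_linearMap_eq_smul_fundamentalClass μ
  obtain ⟨Ψ, -, hΨ⟩ := exists_linearMap_eq_smul_fundamentalClass ν
  have hd := hΨ (singularHomology.map R R e.toFun n μ.fundamentalClass)
  have hd' := hΦ (singularHomology.map R R e.invFun n ν.fundamentalClass)
  refine ⟨Ψ (singularHomology.map R R e.toFun n μ.fundamentalClass),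
    Φ (singularHomology.map R R e.invFun n ν.fundamentalClass), ?_, hd⟩
  have hcomp : singularHomology.map R R e.invFun n
      (singularHomology.map R R e.toFun n μ.fundamentalClass) = μ.fundamentalClass := by
    rw [← ModuleCat.comp_apply, ← singularHomology.map_comp,
      singularHomology.map_eq_of_homotopic R R e.left_inv, singularHomology.map_id,
      ModuleCat.id_apply]
  rw [hd, map_smul, hd', smul_smul] at hcomp
  have h := congrArg Φ hcomp
  rwa [map_smul, hΦ1, smul_eq_mul, mul_one] at h

/-- **A homotopy equivalence between closed connected oriented manifolds has degree `±1`.** For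
closed connected `ℤ`-oriented topological `n`-manifolds `X`, `Y` and a homotopy equivalence
`e : X ≃ₕ Y`, `e_* [X] = [Y]` or `e_* [X] = -[Y]` (Hatcher 2002, §2.2, properties (c), (d) of the
degree, and §3.3, Thm. 3.26 with Exercise 7: `Hₙ ≅ ℤ` generated by the fundamental class, and
`(e⁻¹ ∘ e)_* = 𝟙` forces `deg e · deg e⁻¹ = 1`). [cite: HatcherAT2002, §2.2 (c),(d) and Thm. 3.26] -/
theorem hasDegree_one_or_neg_one_of_homotopyEquiv [CompactSpace X] [T2Space X]
    [ChartedSpace (EuclideanSpace ℝ (Fin n)) X] [ConnectedSpace X] [CompactSpace Y] [T2Space Y]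
    [ChartedSpace (EuclideanSpace ℝ (Fin n)) Y] [ConnectedSpace Y]
    (μ : HomologicalOrientation ℤ X n) (ν : HomologicalOrientation ℤ Y n) (e : X ≃ₕ Y) :
    HasDegree μ ν e.toFun 1 ∨ HasDegree μ ν e.toFun (-1) := by
  obtain ⟨d, d', hdd', hd⟩ := exists_mul_eq_one_map_fundamentalClass_eq_smul μ ν e
  -- `hd` is stated with the `ℤ`-module structure of `Hₙ(Y; ℤ)`; `HasDegree` uses `zsmul`
  rw [← Int.cast_id (n := d), Int.cast_smul_eq_zsmul] at hd
  rcases Int.eq_one_or_neg_one_of_mul_eq_one hdd' with rfl | rfl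
  · exact Or.inl hd
  · exact Or.inr hd

/-! ### The intersection form under a map of degree `d` -/

variable {k : ℕ}

/-- **Naturality of the intersection form under a map of degree `d`.** If `f : X → Y` satisfies
`f_* [X] = d • [Y]` then `Q_X (f^* a) (f^* b) = d · Q_Y a b` on cohomology modulo torsion:
`⟨f^*a ⌣ f^*b, [X]⟩ = ⟨f^*(a ⌣ b), [X]⟩ = ⟨a ⌣ b, f_*[X]⟩ = d ⟨a ⌣ b, [Y]⟩` (Milnor–Husemoller 1973,
§V.1; Hatcher 2002, Prop. 3.10 and §3.1 p. 201 for the two naturalities). No manifold hypothesis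
is needed for this identity. [cite: MilnorHusemoller1973, §V.1] -/
theorem intersectionForm_map_map (h : k + k = n) (μ : HomologicalOrientation ℤ X n)
    (ν : HomologicalOrientation ℤ Y n) {f : C(X, Y)} {d : ℤ} (hf : HasDegree μ ν f d)
    (a b : freeCohomology ℤ Y k) :
    intersectionForm h μ (freeCohomology.map f k a) (freeCohomology.map f k b) =
      d * intersectionForm h ν a b := by
  induction a using freeCohomology.induction_on with
  | h a =>
  induction b using freeCohomology.induction_on with
  | h b =>
    rw [freeCohomology.map_mk, freeCohomology.map_mk, intersectionForm_mk_mk, intersectionForm_mk_mk,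
      cupPairing_apply, cupPairing_apply, ← cupProduct_map, kroneckerPairing_map, hf, map_zsmul,
      smul_eq_mul]

/-! ### Homotopy invariance of the intersection form up to sign -/

/-- **Homotopy invariance of the intersection form (up to orientation).** For closed connected
`ℤ`-oriented topological `2k`-manifolds `X`, `Y` (`h : k + k = n`) and a homotopy equivalence
`e : X ≃ₕ Y`, the intersection forms are isometric up to the sign `deg e = ±1`:
`Q_X ≅ Q_Y` or `Q_X ≅ -Q_Y` (`LinearMap.BilinForm.Equivalent`), the isometry being
`e^* : Hᵏ(Y; ℤ)/T ≃ Hᵏ(X; ℤ)/T` (Milnor–Husemoller 1973, §V.1: the form is an invariant of oriented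
homotopy type; Freedman–Quinn 1990, §10.1: "A homotopy equivalence also induces an isometry of the
form"). [cite: FreedmanQuinn1990, §10.1] -/
theorem equivalent_intersectionForm_or_neg_of_homotopyEquiv [CompactSpace X] [T2Space X]
    [ChartedSpace (EuclideanSpace ℝ (Fin n)) X] [ConnectedSpace X] [CompactSpace Y] [T2Space Y]
    [ChartedSpace (EuclideanSpace ℝ (Fin n)) Y] [ConnectedSpace Y] (h : k + k = n)
    (μ : HomologicalOrientation ℤ X n) (ν : HomologicalOrientation ℤ Y n) (e : X ≃ₕ Y) :
    (intersectionForm h μ).Equivalent (intersectionForm h ν) ∨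
      (intersectionForm h μ).Equivalent (-intersectionForm h ν) := by
  -- `e^*` as a linear equivalence `Hᵏ(Y; ℤ)/T ≃ₗ[ℤ] Hᵏ(X; ℤ)/T`
  let E : freeCohomology ℤ Y k ≃ₗ[ℤ] freeCohomology ℤ X k :=
    LinearEquiv.ofLinear (freeCohomology.map e.toFun k) (freeCohomology.map e.invFun k)
      (freeCohomology_map_comp_map_symm e k) (freeCohomology_map_symm_comp_map e k)
  have hE : ∀ a, E a = freeCohomology.map e.toFun k a := fun _ => rfl
  rcases hasDegree_one_or_neg_one_of_homotopyEquiv μ ν e with he | he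
  · refine Or.inl ⟨LinearMap.BilinForm.IsometryEquiv.symm { E with map_app' := fun a b => ?_ }⟩
    change intersectionForm h μ (E a) (E b) = intersectionForm h ν a b
    rw [hE, hE, intersectionForm_map_map h μ ν he, one_mul]
  · refine Or.inr ⟨LinearMap.BilinForm.IsometryEquiv.symm { E with map_app' := fun a b => ?_ }⟩
    change intersectionForm h μ (E a) (E b) = (-intersectionForm h ν) a b
    rw [hE, hE, intersectionForm_map_map h μ ν he, LinearMap.neg_apply, LinearMap.neg_apply,
      neg_one_mul]

/-! ### spc4.S09, the `→` half -/

/-- **spc4.S09, "only if" (Whitehead 1949; Milnor 1958; Milnor–Husemoller 1973, §V.1;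
Freedman–Quinn 1990, §10.1).** If two closed simply connected topological 4-manifolds `M`, `N`
(with chosen `ℤ`-orientations `μ`, `ν`) are homotopy equivalent, then their intersection forms are
isomorphic up to orientation reversal: `Q_M ≅ Q_N` or `Q_M ≅ -Q_N`. This is the left-to-right
implication of the named fact
`Literature.Topology.FourManifolds.nonempty_homotopyEquiv_iff_equivalent_intersectionForm` in its
intended (2026-08-15 re-stated) form, both manifolds closed (see the module docstring, Part 2,
for the legacy reading of that constant and its refutation); simple connectivity is used only
through connectedness. [cite: FreedmanQuinn1990, §10.1] -/
theorem equivalent_intersectionForm_or_neg_of_nonempty_homotopyEquiv {M : Type u}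
    [TopologicalSpace M] [T2Space M] [ChartedSpace (EuclideanSpace ℝ (Fin 4)) M] [CompactSpace M]
    [SimplyConnectedSpace M] {N : Type u} [TopologicalSpace N] [T2Space N]
    [ChartedSpace (EuclideanSpace ℝ (Fin 4)) N] [CompactSpace N] [SimplyConnectedSpace N]
    (μ : HomologicalOrientation ℤ M 4) (ν : HomologicalOrientation ℤ N 4)
    (hMN : Nonempty (M ≃ₕ N)) :
    (intersectionForm two_add_two μ).Equivalent (intersectionForm two_add_two ν) ∨
      (intersectionForm two_add_two μ).Equivalent (-intersectionForm two_add_two ν) :=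
  equivalent_intersectionForm_or_neg_of_homotopyEquiv two_add_two μ ν hMN.some

/-! ### The legacy reading of `spc4.S09` (manifold hypotheses on `M` dropped) is false

The D-0014 constant `nonempty_homotopyEquiv_iff_equivalent_intersectionForm` of
`IntersectionFormTopology.lean` was written under
`variable {M : Type u} [TopologicalSpace M] [T2Space M] [ChartedSpace (𝔼 4) M] [CompactSpace M]`,
but a `def` only receives the section variables its body uses, and the body used neither
`[T2Space M]`, `[ChartedSpace (𝔼 4) M]` nor `[CompactSpace M]`; it elaborated as
`∀ {M : Type u} [TopologicalSpace M], Prop`, i.e. it spoke about EVERY simply connected space `M`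
carrying a homological `ℤ`-orientation in dimension `4` (the same defect is recorded for
`exists_homologicalOrientation_int_of_simplyConnectedSpace` in `IntersectionFormTopologyProofs.lean`).
So read it is false — take `M = ℝ⁴` (not compact) and `N = S⁴` — which is why it admitted no
`…_holds` and was re-stated (same name, hypotheses on `M` as binders of the statement) in the
2026-08-15 verdict clean-up. The refutation below writes the legacy body out explicitly at
`M := ℝ⁴`, so it is independent of the statement file's constant. -/

section Misstated

open Literature.AlgebraicTopology.FundamentalGroup

/-- Two bilinear forms on zero modules are isometric (the unique linear equivalence `0 ≃ 0` is an
isometry). Auxiliary for the counterexample below. [folklore] -/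
theorem bilinFormInt_equivalent_of_subsingleton {V W : Type*} [AddCommGroup V] [Module ℤ V] [AddCommGroup W]
    [Module ℤ W] [Subsingleton V] [Subsingleton W] (B : LinearMap.BilinForm ℤ V)
    (B' : LinearMap.BilinForm ℤ W) : B.Equivalent B' :=
  have hB : ∀ v₁ v₂ : V, B v₁ v₂ = 0 := fun v₁ v₂ => by
    rw [Subsingleton.elim v₁ 0, map_zero, LinearMap.zero_apply]
  have hB' : ∀ w₁ w₂ : W, B' w₁ w₂ = 0 := fun w₁ w₂ => by
    rw [Subsingleton.elim w₁ 0, map_zero, LinearMap.zero_apply]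
  ⟨{ LinearEquiv.ofSubsingleton V W with map_app' := fun a b => by rw [hB, hB'] }⟩

/-- `H²(X; ℤ)/T = 0` as soon as `H₁(X; ℤ) = 0` and `H₂(X; ℤ) = 0`: the Kronecker map
`H²(X; ℤ) → Hom(H₂(X; ℤ), ℤ) = 0` is then injective (universal coefficients with vanishing `Ext`,
Hatcher 2002, §3.1, Thm. 3.2; tree theorem `kroneckerPairing_bijective_of_isZero`), so already
`H²(X; ℤ) = 0`. [cite: HatcherAT2002, §3.1 Thm. 3.2 (p. 195)] -/
theorem freeCohomology_two_eq_zero_of_isZero {X : Type u} [TopologicalSpace X]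
    (h₁ : IsZero (singularHomology ℤ ℤ X 1)) (h₂ : IsZero (singularHomology ℤ ℤ X 2))
    (x : freeCohomology ℤ X 2) : x = 0 := by
  haveI := ModuleCat.subsingleton_of_isZero h₂
  haveI : Subsingleton (singularCohomology ℤ ℤ X 2) :=
    (kroneckerPairing_bijective_of_isZero ℤ X 1 h₁).1.subsingleton
  induction x using freeCohomology.induction_on with
  | h a => rw [Subsingleton.elim a 0, map_zero]

/-- **The legacy reading of `spc4.S09` — "`M` any simply connected space with a homological
`ℤ`-orientation in dimension `4`, `N` a closed simply connected 4-manifold" — is false.** This is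
the body of the D-0014 constant `nonempty_homotopyEquiv_iff_equivalent_intersectionForm` as it
elaborated before the 2026-08-15 re-statement (closed-manifold hypotheses on `M` dropped, see the
module docstring, Part 2), written out at `M = ℝ⁴ = EuclideanSpace ℝ (Fin 4)` (its inhabited
leading binder `[SimplyConnectedSpace ℝ⁴]` omitted). It fails against `N = S⁴`: both
`H²(ℝ⁴; ℤ)/T` and `H²(S⁴; ℤ)/T` vanish (`ℝ⁴` is contractible; `H₁(S⁴) = H₂(S⁴) = 0`, Hatcher 2002,
Cor. 2.14), so the two intersection forms — zero forms on zero modules — are isometric and the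
right-hand side holds; but `ℝ⁴ ≃ₕ S⁴` is impossible, since `H₄(ℝ⁴; ℤ) = 0` while
`[S⁴] ≠ 0 ∈ H₄(S⁴; ℤ)` (Hatcher 2002, Thm. 3.26). The intended statement (both `M` and `N` closed
simply connected topological 4-manifolds, hypotheses as binders of the statement itself) is the
Whitehead–Milnor theorem; its "only if" half is
`equivalent_intersectionForm_or_neg_of_nonempty_homotopyEquiv` above. [cite: HatcherAT2002, Cor. 2.14 and Thm. 3.26] -/
theorem not_nonempty_homotopyEquiv_iff_equivalent_intersectionForm_euclideanSpace :
    ¬ ∀ {N : Type} [TopologicalSpace N] [T2Space N] [ChartedSpace (EuclideanSpace ℝ (Fin 4)) N]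
        [CompactSpace N] [SimplyConnectedSpace N]
        (μ : HomologicalOrientation ℤ (EuclideanSpace ℝ (Fin 4)) 4) (ν : HomologicalOrientation ℤ N 4),
        Nonempty (EuclideanSpace ℝ (Fin 4) ≃ₕ N) ↔
          (intersectionForm two_add_two μ).Equivalent (intersectionForm two_add_two ν) ∨
            (intersectionForm two_add_two μ).Equivalent (-intersectionForm two_add_two ν) := by
  intro h
  -- the closed simply connected 4-manifold `N = S⁴ ⊂ ℝ⁵`
  haveI := Fact.mk (@finrank_euclideanSpace_fin ℝ _ (4 + 1))
  haveI : SimplyConnectedSpace (Metric.sphere (0 : EuclideanSpace ℝ (Fin (4 + 1))) 1) :=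
    simplyConnectedSpace_euclideanSphere 4 (by norm_num)
  obtain ⟨ν⟩ := nonempty_homologicalOrientation_int_four_of_simplyConnectedSpace
    (M := Metric.sphere (0 : EuclideanSpace ℝ (Fin (4 + 1))) 1)
  obtain ⟨μ⟩ := nonempty_homologicalOrientation_int_four_of_simplyConnectedSpace
    (M := EuclideanSpace ℝ (Fin 4))
  have key := @h (Metric.sphere (0 : EuclideanSpace ℝ (Fin (4 + 1))) 1)
    inferInstance inferInstance inferInstance inferInstance inferInstance μ ν
  -- `ℝ⁴` is contractible: its homology vanishes in positive degrees
  obtain ⟨ε⟩ := ContractibleSpace.hequiv (EuclideanSpace ℝ (Fin 4)) PUnit.{1}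
  have hE : ∀ k : ℕ, k ≠ 0 → IsZero (singularHomology ℤ ℤ (EuclideanSpace ℝ (Fin 4)) k) :=
    fun k hk => (isZero_singularHomology_of_subsingleton ℤ ℤ (X := PUnit.{1}) hk).of_iso
      (singularHomology.isoOfHomotopyEquiv ℤ ℤ ε k)
  -- the right-hand side holds: both forms live on the zero module
  have hM : ∀ x : freeCohomology ℤ (EuclideanSpace ℝ (Fin 4)) 2, x = 0 :=
    freeCohomology_two_eq_zero_of_isZero (hE 1 one_ne_zero) (hE 2 two_ne_zero)
  have hN : ∀ x : freeCohomology ℤ (Metric.sphere (0 : EuclideanSpace ℝ (Fin (4 + 1))) 1) 2, x = 0 :=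
    freeCohomology_two_eq_zero_of_isZero
      (isZero_singularHomology_sphere_holds ℤ ℤ (n := 4) (k := 1) one_ne_zero (by decide))
      (isZero_singularHomology_sphere_holds ℤ ℤ (n := 4) (k := 2) two_ne_zero (by decide))
  haveI : Subsingleton (freeCohomology ℤ (EuclideanSpace ℝ (Fin 4)) 2) :=
    ⟨fun x y => (hM x).trans (hM y).symm⟩
  haveI : Subsingleton (freeCohomology ℤ (Metric.sphere (0 : EuclideanSpace ℝ (Fin (4 + 1))) 1) 2) :=
    ⟨fun x y => (hN x).trans (hN y).symm⟩
  obtain ⟨e⟩ := key.mpr (Or.inl (bilinFormInt_equivalent_of_subsingleton _ _))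
  -- but `ℝ⁴ ≃ₕ S⁴` kills `H₄(S⁴; ℤ)`, which contains `[S⁴] ≠ 0`
  have h4 : IsZero (singularHomology ℤ ℤ (Metric.sphere (0 : EuclideanSpace ℝ (Fin (4 + 1))) 1) 4) :=
    (hE 4 (by decide)).of_iso (singularHomology.isoOfHomotopyEquiv ℤ ℤ e 4).symm
  haveI := ModuleCat.subsingleton_of_isZero h4
  obtain ⟨x⟩ := (inferInstance : Nonempty (Metric.sphere (0 : EuclideanSpace ℝ (Fin (4 + 1))) 1))
  obtain ⟨φ, hφ⟩ := ν.isGenerator x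
  have hfc := HomologicalOrientation.isFundamentalClass_fundamentalClass_holds (R := ℤ)
    (X := Metric.sphere (0 : EuclideanSpace ℝ (Fin (4 + 1))) 1) 4 ν x
  rw [Subsingleton.elim ν.fundamentalClass 0, map_zero] at hfc
  rw [← hfc, map_zero] at hφ
  exact zero_ne_one hφ

end Misstated

end Literature.Topology.FourManifolds
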